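import Summits.BirchSwinnertonDyer.Rank1Residual.WAll.AltClosersResidualCellsAtTwo
import HarnessLib

/-!
# Rung W-ALL (D-0120): ALT-CLOSERS BY NAME for the cells of row 1 (`NonCMAtTwo`) cut out by route
# `ThetaPartnerAtTwo` — REV 7 spelling: the CM partner of the theta habitat has ANALYTIC RANK 0
# (item stmt-BirchSwinnertonDyer-20334 verbatim; cell `bsd-wall`, lane 2, seat ty-2 g5)

HONEST FRAMING (cell `bsd-wall`, run/shared/lean/pub/bsd-wall/; WALL-BRIEF-v1 §2; companion of
`WAll/AltClosersResidualCellsAtTwo.lean` §1 (sketch spelling `a_ℓ ≡ (mod 2)`) and §2 (rev-0 spelling,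
item 20310: a `Gal(ℚ̄/ℚ)`-equivariant isomorphism `E[2](ℚ̄) ≃ A[2](ℚ̄)`), same rules: NOTHING ASSERTED,
no `def`, no `@[conjecture]`, no named fact, NO ROUTE FILE IMPORTED).

WHY A THIRD SPELLING. `ledger route edit` rev 7 of `route-BirchSwinnertonDyer-ThetaPartnerAtTwo`
(commit 0685c8cef1f0, 2026-08-27T07:59Z; tp2-p1 audit «K1 MISSTATED»: crux K1 `SignedTransportAtTwo`
restated 1:1 as item 20333 FRAMED by the partner's analytic data) also RESTATED the residual: item
20310 is CLOSED·superseded and the live residual is **item 20334 `OffThetaHabitatAtTwo`**, whose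
habitat carries ONE MORE conjunct — the CM partner `A` has `A.analyticRank = 0` (so that Kobayashi's
main conjecture for `A` at `2` is instantiated at a rank-`0` CM curve):
`¬ (r_an(W) = 0 ∧ GoodSS W 2 ∧ a₂(W) = 0 ∧ ∃ A CM, r_an(A) = 0 ∧ GoodSS A 2 ∧ a₂(A) = 0 ∧ E[2] ≃_{Gal} A[2]) → BSDp W 2`.
The five theorems of `AltClosersResidualCellsAtTwo.lean` §2 are repeated on THAT spelling (suffix
`_r0Partner`), VERBATIM, so the rev-7 `closes` and its items feed in unchanged; the proofs are the
same case splits (nothing about the habitat predicate is used except that it is a predicate). §2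
records that the rev-7 residual IMPLIES the rev-0 residual (the habitat shrank, the complement grew),
so every closer of the rev-0 shape stays usable downstream of 20334.

* §1 `offThetaHabitatAtTwo_r0Partner_of_nonCMAtTwo` (20334 ⇐ LEAF K4),
  `nonCMAtTwo_of_thetaHabitat_of_offThetaHabitat_r0Partner` (row 1 ⇐ habitat cell + 20334),
  `thetaHabitat_offThetaHabitat_r0Partner_of_nonCMAtTwo` (exactness),
  `offThetaHabitatAtTwo_r0Partner_of_reductionTypesAtTwo_of_ssOffHabitat` (20334 ⇐ K4 items 19095 /
  19096 / 19098 / 19099 verbatim + 19097 off the habitat),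
  `supersingularRankZeroAtTwo_of_thetaHabitat_r0Partner_of_ssOffHabitat` (19097 ⇐ habitat + remainder);
* §2 `offThetaHabitatAtTwo_torsionIso_of_r0Partner` (20334 shape ⇒ 20310 shape).

References: `WAll/AltClosers.lean` §X5, `WAll/AltClosersResidualCellsAtTwo.lean` §2 (p504781);
`ledger route show route-BirchSwinnertonDyer-ThetaPartnerAtTwo` rev 7; [cite: Kobayashi2003, Thm. 1.2 and
Thm. 4.1 (the signed main conjecture; shape only, nothing asserted)].
-/

noncomputable section

open scoped Classical

open WeierstrassCurve Literature.NumberTheory.EllipticCurves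
  Literature.NumberTheory.EllipticCurves.Rank1Residual

set_option autoImplicit false

namespace Summit.BirchSwinnertonDyer.Rank1Residual.WAll

open Summit.BirchSwinnertonDyer.BirchSwinnertonDyer.Rank1Residual (NonCMAtTwo)

/-! ## §1 The five row-1 closers on the rev-7 spelling (item 20334 verbatim) -/

/-- **Item 20334 `OffThetaHabitatAtTwo` (rev-7 shape, verbatim) ⇐ LEAF K4 `NonCMAtTwo`** — the
residual is row 1 RESTRICTED off the rank-0-partner habitat: rung-K4 territory. [folklore] -/
theorem offThetaHabitatAtTwo_r0Partner_of_nonCMAtTwo (h : NonCMAtTwo) :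
    ∀ (W : WeierstrassCurve ℚ) [W.IsElliptic] [W.IsGloballyMinimal], ¬ W.HasCM →
      W.analyticRank ≤ 1 →
      ¬ (W.analyticRank = 0 ∧ GoodSS W 2 ∧ W.frobeniusTrace 2 = 0 ∧
          ∃ (A : WeierstrassCurve ℚ) (_ : A.IsElliptic) (_ : A.IsGloballyMinimal),
            A.HasCM ∧ A.analyticRank = 0 ∧ GoodSS A 2 ∧ A.frobeniusTrace 2 = 0 ∧
              ∃ e : WeierstrassCurve.geomTorsion W (2 : ℤ) ≃+ WeierstrassCurve.geomTorsion A (2 : ℤ),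
                ∀ (σ : Field.absoluteGaloisGroup ℚ) (P : WeierstrassCurve.geomTorsion W (2 : ℤ)),
                  e (σ • P) = σ • e P) →
      BSDp W 2 :=
  fun W _ _ hcm hr _ ↦ h W hcm hr

/-- **Row 1 from the rank-0-partner habitat cell and the landed residual 20334.** [folklore] -/
theorem nonCMAtTwo_of_thetaHabitat_of_offThetaHabitat_r0Partner
    (hHab : ∀ (W : WeierstrassCurve ℚ) [W.IsElliptic] [W.IsGloballyMinimal], ¬ W.HasCM →
      W.analyticRank = 0 → GoodSS W 2 → W.frobeniusTrace 2 = 0 →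
      (∃ (A : WeierstrassCurve ℚ) (_ : A.IsElliptic) (_ : A.IsGloballyMinimal),
            A.HasCM ∧ A.analyticRank = 0 ∧ GoodSS A 2 ∧ A.frobeniusTrace 2 = 0 ∧
              ∃ e : WeierstrassCurve.geomTorsion W (2 : ℤ) ≃+ WeierstrassCurve.geomTorsion A (2 : ℤ),
                ∀ (σ : Field.absoluteGaloisGroup ℚ) (P : WeierstrassCurve.geomTorsion W (2 : ℤ)),
                  e (σ • P) = σ • e P) →
      BSDp W 2)
    (hOff : ∀ (W : WeierstrassCurve ℚ) [W.IsElliptic] [W.IsGloballyMinimal], ¬ W.HasCM →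
      W.analyticRank ≤ 1 →
      ¬ (W.analyticRank = 0 ∧ GoodSS W 2 ∧ W.frobeniusTrace 2 = 0 ∧
          ∃ (A : WeierstrassCurve ℚ) (_ : A.IsElliptic) (_ : A.IsGloballyMinimal),
            A.HasCM ∧ A.analyticRank = 0 ∧ GoodSS A 2 ∧ A.frobeniusTrace 2 = 0 ∧
              ∃ e : WeierstrassCurve.geomTorsion W (2 : ℤ) ≃+ WeierstrassCurve.geomTorsion A (2 : ℤ),
                ∀ (σ : Field.absoluteGaloisGroup ℚ) (P : WeierstrassCurve.geomTorsion W (2 : ℤ)),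
                  e (σ • P) = σ • e P) →
      BSDp W 2) :
    NonCMAtTwo := by
  intro W _ _ hcm hr
  by_cases hH : (W.analyticRank = 0 ∧ GoodSS W 2 ∧ W.frobeniusTrace 2 = 0 ∧
      ∃ (A : WeierstrassCurve ℚ) (_ : A.IsElliptic) (_ : A.IsGloballyMinimal),
            A.HasCM ∧ A.analyticRank = 0 ∧ GoodSS A 2 ∧ A.frobeniusTrace 2 = 0 ∧
              ∃ e : WeierstrassCurve.geomTorsion W (2 : ℤ) ≃+ WeierstrassCurve.geomTorsion A (2 : ℤ),
                ∀ (σ : Field.absoluteGaloisGroup ℚ) (P : WeierstrassCurve.geomTorsion W (2 : ℤ)),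
                  e (σ • P) = σ • e P)
  · exact hHab W hcm hH.1 hH.2.1 hH.2.2.1 hH.2.2.2
  · exact hOff W hcm hr hH

/-- **Exactness of the rank-0-partner habitat split of row 1**: both cells follow from
`NonCMAtTwo`. [folklore] -/
theorem thetaHabitat_offThetaHabitat_r0Partner_of_nonCMAtTwo (h : NonCMAtTwo) :
    (∀ (W : WeierstrassCurve ℚ) [W.IsElliptic] [W.IsGloballyMinimal], ¬ W.HasCM →
      W.analyticRank = 0 → GoodSS W 2 → W.frobeniusTrace 2 = 0 →
      (∃ (A : WeierstrassCurve ℚ) (_ : A.IsElliptic) (_ : A.IsGloballyMinimal),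
            A.HasCM ∧ A.analyticRank = 0 ∧ GoodSS A 2 ∧ A.frobeniusTrace 2 = 0 ∧
              ∃ e : WeierstrassCurve.geomTorsion W (2 : ℤ) ≃+ WeierstrassCurve.geomTorsion A (2 : ℤ),
                ∀ (σ : Field.absoluteGaloisGroup ℚ) (P : WeierstrassCurve.geomTorsion W (2 : ℤ)),
                  e (σ • P) = σ • e P) →
      BSDp W 2) ∧
    (∀ (W : WeierstrassCurve ℚ) [W.IsElliptic] [W.IsGloballyMinimal], ¬ W.HasCM →
      W.analyticRank ≤ 1 →
      ¬ (W.analyticRank = 0 ∧ GoodSS W 2 ∧ W.frobeniusTrace 2 = 0 ∧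
          ∃ (A : WeierstrassCurve ℚ) (_ : A.IsElliptic) (_ : A.IsGloballyMinimal),
            A.HasCM ∧ A.analyticRank = 0 ∧ GoodSS A 2 ∧ A.frobeniusTrace 2 = 0 ∧
              ∃ e : WeierstrassCurve.geomTorsion W (2 : ℤ) ≃+ WeierstrassCurve.geomTorsion A (2 : ℤ),
                ∀ (σ : Field.absoluteGaloisGroup ℚ) (P : WeierstrassCurve.geomTorsion W (2 : ℤ)),
                  e (σ • P) = σ • e P) →
      BSDp W 2) :=
  ⟨fun W _ _ hcm h0 _ _ _ ↦ h W hcm (by rw [h0]; exact zero_le_one),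
    offThetaHabitatAtTwo_r0Partner_of_nonCMAtTwo h⟩

/-- **The landed residual 20334 at SUB-CLASS granularity ⇐ the rung-K4 route items** 19095
`GoodOrdinaryRankZeroAtTwo` · 19096 `MultiplicativeRankZeroAtTwo` · 19098 `AdditiveRankZeroAtTwo` ·
19099 `RankOneAtTwo` (verbatim) + item 19097 `SupersingularRankZeroAtTwo` restricted OFF the
rank-0-partner habitat. [folklore] -/
theorem offThetaHabitatAtTwo_r0Partner_of_reductionTypesAtTwo_of_ssOffHabitat
    (hOrd : ∀ (W : WeierstrassCurve ℚ) [W.IsElliptic] [W.IsGloballyMinimal],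
      ¬ W.HasCM → W.analyticRank = 0 → GoodOrd W 2 → BSDp W 2)
    (hMult : ∀ (W : WeierstrassCurve ℚ) [W.IsElliptic] [W.IsGloballyMinimal],
      ¬ W.HasCM → W.analyticRank = 0 → Mult W 2 → BSDp W 2)
    (hAdd : ∀ (W : WeierstrassCurve ℚ) [W.IsElliptic] [W.IsGloballyMinimal],
      ¬ W.HasCM → W.analyticRank = 0 → Addv W 2 → BSDp W 2)
    (hR1 : ∀ (W : WeierstrassCurve ℚ) [W.IsElliptic] [W.IsGloballyMinimal],
      ¬ W.HasCM → W.analyticRank = 1 → BSDp W 2)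
    (hSSoff : ∀ (W : WeierstrassCurve ℚ) [W.IsElliptic] [W.IsGloballyMinimal],
      ¬ W.HasCM → W.analyticRank = 0 → GoodSS W 2 →
      ¬ (W.frobeniusTrace 2 = 0 ∧
          ∃ (A : WeierstrassCurve ℚ) (_ : A.IsElliptic) (_ : A.IsGloballyMinimal),
            A.HasCM ∧ A.analyticRank = 0 ∧ GoodSS A 2 ∧ A.frobeniusTrace 2 = 0 ∧
              ∃ e : WeierstrassCurve.geomTorsion W (2 : ℤ) ≃+ WeierstrassCurve.geomTorsion A (2 : ℤ),
                ∀ (σ : Field.absoluteGaloisGroup ℚ) (P : WeierstrassCurve.geomTorsion W (2 : ℤ)),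
                  e (σ • P) = σ • e P) →
      BSDp W 2) :
    ∀ (W : WeierstrassCurve ℚ) [W.IsElliptic] [W.IsGloballyMinimal], ¬ W.HasCM →
      W.analyticRank ≤ 1 →
      ¬ (W.analyticRank = 0 ∧ GoodSS W 2 ∧ W.frobeniusTrace 2 = 0 ∧
          ∃ (A : WeierstrassCurve ℚ) (_ : A.IsElliptic) (_ : A.IsGloballyMinimal),
            A.HasCM ∧ A.analyticRank = 0 ∧ GoodSS A 2 ∧ A.frobeniusTrace 2 = 0 ∧
              ∃ e : WeierstrassCurve.geomTorsion W (2 : ℤ) ≃+ WeierstrassCurve.geomTorsion A (2 : ℤ),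
                ∀ (σ : Field.absoluteGaloisGroup ℚ) (P : WeierstrassCurve.geomTorsion W (2 : ℤ)),
                  e (σ • P) = σ • e P) →
      BSDp W 2 := by
  intro W _ _ hcm hr hH
  rcases Nat.le_one_iff_eq_zero_or_eq_one.mp hr with h0 | h1
  · by_cases hg : W.HasGoodReductionAtPrime 2
    · by_cases ha : (2 : ℤ) ∣ W.frobeniusTrace 2
      · have hss : GoodSS W 2 := ⟨hg, by exact_mod_cast ha⟩
        exact hSSoff W hcm h0 hss (fun hrest ↦ hH ⟨h0, hss, hrest⟩)
      · exact hOrd W hcm h0 ⟨hg, by exact_mod_cast ha⟩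
    · by_cases hm : W.HasMultiplicativeReductionAtPrime 2
      · exact hMult W hcm h0 hm
      · exact hAdd W hcm h0 ⟨hg, hm⟩
  · exact hR1 W hcm h1

/-- **Item 19097 `SupersingularRankZeroAtTwo` (K4, verbatim) from the (torsion-isomorphism)
habitat cell and its off-habitat remainder.** [folklore] -/
theorem supersingularRankZeroAtTwo_of_thetaHabitat_r0Partner_of_ssOffHabitat
    (hHab : ∀ (W : WeierstrassCurve ℚ) [W.IsElliptic] [W.IsGloballyMinimal], ¬ W.HasCM →
      W.analyticRank = 0 → GoodSS W 2 → W.frobeniusTrace 2 = 0 →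
      (∃ (A : WeierstrassCurve ℚ) (_ : A.IsElliptic) (_ : A.IsGloballyMinimal),
            A.HasCM ∧ A.analyticRank = 0 ∧ GoodSS A 2 ∧ A.frobeniusTrace 2 = 0 ∧
              ∃ e : WeierstrassCurve.geomTorsion W (2 : ℤ) ≃+ WeierstrassCurve.geomTorsion A (2 : ℤ),
                ∀ (σ : Field.absoluteGaloisGroup ℚ) (P : WeierstrassCurve.geomTorsion W (2 : ℤ)),
                  e (σ • P) = σ • e P) →
      BSDp W 2)
    (hSSoff : ∀ (W : WeierstrassCurve ℚ) [W.IsElliptic] [W.IsGloballyMinimal],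
      ¬ W.HasCM → W.analyticRank = 0 → GoodSS W 2 →
      ¬ (W.frobeniusTrace 2 = 0 ∧
          ∃ (A : WeierstrassCurve ℚ) (_ : A.IsElliptic) (_ : A.IsGloballyMinimal),
            A.HasCM ∧ A.analyticRank = 0 ∧ GoodSS A 2 ∧ A.frobeniusTrace 2 = 0 ∧
              ∃ e : WeierstrassCurve.geomTorsion W (2 : ℤ) ≃+ WeierstrassCurve.geomTorsion A (2 : ℤ),
                ∀ (σ : Field.absoluteGaloisGroup ℚ) (P : WeierstrassCurve.geomTorsion W (2 : ℤ)),
                  e (σ • P) = σ • e P) →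
      BSDp W 2) :
    ∀ (W : WeierstrassCurve ℚ) [W.IsElliptic] [W.IsGloballyMinimal],
      ¬ W.HasCM → W.analyticRank = 0 → GoodSS W 2 → BSDp W 2 := by
  intro W _ _ hcm h0 hss
  by_cases hrest : (W.frobeniusTrace 2 = 0 ∧
      ∃ (A : WeierstrassCurve ℚ) (_ : A.IsElliptic) (_ : A.IsGloballyMinimal),
            A.HasCM ∧ A.analyticRank = 0 ∧ GoodSS A 2 ∧ A.frobeniusTrace 2 = 0 ∧
              ∃ e : WeierstrassCurve.geomTorsion W (2 : ℤ) ≃+ WeierstrassCurve.geomTorsion A (2 : ℤ),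
                ∀ (σ : Field.absoluteGaloisGroup ℚ) (P : WeierstrassCurve.geomTorsion W (2 : ℤ)),
                  e (σ • P) = σ • e P)
  · exact hHab W hcm h0 hss hrest.1 hrest.2
  · exact hSSoff W hcm h0 hss hrest

/-! ## §2 The rev-7 residual implies the rev-0 residual (bookkeeping) -/

/-- **Item 20334 (rev 7) ⇒ item 20310's statement (rev 0).** The rev-7 habitat is contained in the
rev-0 habitat (one more conjunct on the partner), so `BSD(E,2)` off the smaller habitat gives it off
the larger one. [folklore] -/
theorem offThetaHabitatAtTwo_torsionIso_of_r0Partner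
    (h : ∀ (W : WeierstrassCurve ℚ) [W.IsElliptic] [W.IsGloballyMinimal], ¬ W.HasCM →
      W.analyticRank ≤ 1 →
      ¬ (W.analyticRank = 0 ∧ GoodSS W 2 ∧ W.frobeniusTrace 2 = 0 ∧
          ∃ (A : WeierstrassCurve ℚ) (_ : A.IsElliptic) (_ : A.IsGloballyMinimal),
            A.HasCM ∧ A.analyticRank = 0 ∧ GoodSS A 2 ∧ A.frobeniusTrace 2 = 0 ∧
              ∃ e : WeierstrassCurve.geomTorsion W (2 : ℤ) ≃+ WeierstrassCurve.geomTorsion A (2 : ℤ),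
                ∀ (σ : Field.absoluteGaloisGroup ℚ) (P : WeierstrassCurve.geomTorsion W (2 : ℤ)),
                  e (σ • P) = σ • e P) →
      BSDp W 2) :
    ∀ (W : WeierstrassCurve ℚ) [W.IsElliptic] [W.IsGloballyMinimal], ¬ W.HasCM →
      W.analyticRank ≤ 1 →
      ¬ (W.analyticRank = 0 ∧ GoodSS W 2 ∧ W.frobeniusTrace 2 = 0 ∧
          ∃ (A : WeierstrassCurve ℚ) (_ : A.IsElliptic) (_ : A.IsGloballyMinimal),
            A.HasCM ∧ GoodSS A 2 ∧ A.frobeniusTrace 2 = 0 ∧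
              ∃ e : WeierstrassCurve.geomTorsion W (2 : ℤ) ≃+ WeierstrassCurve.geomTorsion A (2 : ℤ),
                ∀ (σ : Field.absoluteGaloisGroup ℚ) (P : WeierstrassCurve.geomTorsion W (2 : ℤ)),
                  e (σ • P) = σ • e P) →
      BSDp W 2 := by
  intro W _ _ hcm hr hH
  refine h W hcm hr fun hH7 ↦ hH ?_
  obtain ⟨h0, hss, ha, A, iA, iM, hA, -, hgA, haA, e, he⟩ := hH7
  exact ⟨h0, hss, ha, A, iA, iM, hA, hgA, haA, e, he⟩

end Summit.BirchSwinnertonDyer.Rank1Residual.WAll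

end
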